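import Summits.QuantumFields.YangMills.Theorems.BalabanUVNodesN12WindowGaugeLetterLocal
import HarnessLib

/-!
# BalabanUVNodes ∕ N12 — WINDOW-NEAR REGION GEOMETRY: a fine point reached by a short word from `Ω_k(Z)`, a coordinate box around it, and the base of the segment plaquette family of a member read
# from such a point, all lie in the class region ONE LEVEL BELOW THE WINDOW (`topSeq Ω₀ Ω (k−1)`) — the lattice half of the `k`-uniform window gauge letter (`…N12WindowGradedLetters`,
# `…N12WindowGaugeLetterUniform`)

Cell `pub-ymgap` (HUMAN RULINGS D-0062 ∕ D-0149), WIDTH SEAT `pub-ymgap-dag-n12-w6` g7 (node N12 = [B15]; key K1⁹ `stmt-QuantumFields-27364`, `--kind proof --supports … --as helper`;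
count-neutral).  THEOREMS ONLY (0 `def`, 0 `instance`, 0 `sorry`).  Lattice bookkeeping over landed
theorems BY NAME: [III] (2.13)'s printed collar `B14.Eq213DetSet.dist_maxDomT` (within `L^k·M₁ − 1` of a point over `Ω_k` lies `Ω_{k−1}`), NODE 00's support layer `cover_mem_hullD_one_of_within` (`k = 1`),
dag-n12-w3's `exists_cover_of_mem_boxPlaqs` and `N12SegmentPlaqFamily.embIter_apply_of_add`, the word dictionary `LatticeWordCountBox.walkEnd_castSite`, w6 g1's `embIter_tgt_eq_walkEnd_replicate`.

WHY (dag-n12-w3's SCALING caveat; lane census axis U1 «uniformity in k», dag-n12-c g21).  The window gauge letter of `…N12WindowGaugeLetterLocal` (p671561) bounds the Stokes loops with the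
scale-`0` plaquette letter and the chains with a constant iterated-average plaquette bound, so its tolerance grows like `(m′)²L^{2k}·ε`.  But the window sits in `Ω_k(Z)` (`hΩw`): every window
point, every Stokes box around it (radius `∼ (6d+m′)L^k`) and every member the root chains of window bonds read (within `ℓ_k + m′L^k + L^k` of the window) lies within the printed collar
`L^k·M₁` of `Ω_k`, hence in `Ω_{k−1}` — where the class ∕ [15] Thm 1 (8) give plaquettes `ε·η_{k−1}² = ε·L^{2−2k}`-small.  THIS FILE is that geometry.
* §1 `abs_netDisp_le_length`, `walkEnd_eq_cover_and_within` (the end of a word is the projection of `lift x₀ + netDisp w`, within `|w|`), ★ `cover_mem_topSeq_pred_of_within` (within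
  `L^{K−1}M₁ − 1` of a point over `Ω_K` ⇒ in `topSeq Ω₀ Ω (K−1)`; `K ≥ 2`: `dist_maxDomT`; `K = 1`: the support layer), ★★ `boxPlaqs_subset_plaqsOf_topSeq_pred` (the coordinate box of radius `R`
  around a point reached from `Ω_K` by a word of length `≤ D₀` lies in `plaqsOf (topSeq Ω₀ Ω (K−1))` once `D₀ + R + 3 ≤ L^{K−1}M₁`).
* §2 `exists_offset_src_of_endpoint`, ★★ `base_subset_topSeq_window` (the base of dag-n12-w3's segment family of a level-`i` bond one of whose end centres is reached from `Ω_K` by two short words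
  lies in `plaqsOf (topSeq Ω₀ Ω (K−1))` — read at the WINDOW's depth, whatever the member's own level), `exists_word_endpoints` (between the end centres of one bond by `≤ Lⁱ` letters).

HONEST FRAMING.  Lattice bookkeeping and composition by name over landed kernel theorems; the minimiser ([15] Thm 1 ∕ the lane's (E)), its graded plaquette letter, the region datum, the window
rows and the numerics stay HYPOTHESES; the constants are `C(d, L)` — uniform in the level `k` and in the volume, but NOT print's `O(1)` bookkeeping of [15] (16)–(18) verbatim; nothing of
Bałaban's asserted beyond the cited tree theorems; count-neutral; N12 NOT discharged; K1⁹ NOT closed; counts unmoved (typed 28∕28 · discharged 5∕27); one finite 𝕋⁴ programme at fixed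
`ε = L^{-K}` — R4 closes the conditional rung `BalabanLadder.UV` only; no summit statement is proved here and NOT the Yang–Mills mass gap (Clay); nothing continuum ∕ ℝ⁴ ∕ OS.

References: [Balaban1985Variational] CMP 102 (1985) 277–309, (2)–(4) p.278, Thm 1 (8) p.279, (16)–(18) p.280; [Balaban1985RegularSpaces] CMP 98 (1985), (1.7) p.77, (1.19) p.79;
[Balaban1985Averaging] CMP 98 (1985) 17–51, (19)–(20) p.21, Prop. 2 (52)–(53) p.26; [Balaban1988Convergent] CMP 119 (1988) 243–285, p.255, (2.2) p.255, (2.11)–(2.13) pp.256–257, (2.16)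
p.257; [Balaban1987RG1] CMP 109 (1987), (0.1) p.251; [Balaban1989LargeFieldII] CMP 122 (1989) 355–392, p.357.
-/

noncomputable section

open scoped Matrix.Norms.L2Operator BigOperators

namespace Summit.QuantumFields.YangMills.BalabanUVNodes.N12WindowNearRegionGeometry

open Literature.MathematicalPhysics.QuantumFieldTheory.Balaban1983to89
open T4Continuum GaugeField B15DeterminingSets BlockAveraging
open T4CubeChartGnomonic (SU2)
open B16Sect1Backgrounds (toMS)
open T4AxialGaugeSmallField (boxPlaqs castSite)
open B14.Eq213MaximalDomains (side)
open B14.Eq213DetSet (Bj maxDomT maxDomT_antitone dist_maxDomT)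
open B14.Eq216Concrete (inputs)
open B14.Eq22Determines (blockIter)
open B14DomainGeom (Within Pt)
open B15Eq112TorusCover (cover lift cover_lift cover_apply)
open B5Eq118OneStroke (iterBlockOf)
open B8Eq17ClassAkV1 (plaqsOf)
open ExpMeanLog (expMeanLogSU deltaSU)
open Literature.MathematicalPhysics.QuantumFieldTheory.BalabanImbrieJaffe1984to88.BIJ85Eq453GaugeField (qsstarGIter0)
open LatticeWordCountBox (netDisp_le_count_true neg_count_false_le_netDisp walkEnd_castSite)
open Summit.QuantumFields.YangMills.BalabanUVNodes.N12GaugeLetterLocOfClass (exists_cover_of_mem_boxPlaqs)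

variable {P : Params}

/-! ## §1 A point reached by a word from `Ω_K`, and a coordinate box around it, lie in the region one level down -/

/-- `|netDisp w ν| ≤ |w|`: a word moves each coordinate by at most its length. [folklore] -/
theorem abs_netDisp_le_length (w : List (Letter P.d)) (ν : Fin P.d) : |netDisp w ν| ≤ (w.length : ℤ) := by
  have h1 := netDisp_le_count_true ν w
  have h2 := neg_count_false_le_netDisp ν w
  have h3 : (w.count (ν, true) : ℤ) ≤ w.length := by exact_mod_cast List.count_le_length
  have h4 : (w.count (ν, false) : ℤ) ≤ w.length := by exact_mod_cast List.count_le_length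
  rw [abs_le]; constructor <;> linarith

/-- The end of a word `w` from a fine site `x₀` is the projection of the integer point `lift x₀ + netDisp w`, which is within `|w|` of `lift x₀`. [folklore] -/
theorem walkEnd_eq_cover_and_within (x₀ : Site P 0) (w : List (Letter P.d)) :
    walkEnd x₀ w = cover P (fun ν => lift P x₀ ν + netDisp w ν) ∧ Within (w.length : ℤ) (lift P x₀) (fun ν => lift P x₀ ν + netDisp w ν) := by
  refine ⟨?_, fun ν => ?_⟩
  · have h := walkEnd_castSite (P := P) (j := 0) (lift P x₀) w
    have hx : (castSite (lift P x₀) : Site P 0) = x₀ := cover_lift x₀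
    rw [hx] at h
    exact h
  · simp only [sub_add_cancel_left, abs_neg]
    exact abs_netDisp_le_length w ν

/-- ★ **A POINT WITHIN `L^K·M₁ − 1` OF `Ω_K` LIES IN THE CLASS REGION ONE LEVEL DOWN** (`topSeq Ω₀ Ω (K−1)`: the printed collar `Ω_{K−1}` for `K ≥ 2` ([III] (2.13), `dist_maxDomT`), the
support `Ω₀ = hullD M₁ 1 Ω₁` for `K = 1` (`cover_mem_hullD_one_of_within`, within `M₁`)). [cite: Balaban1988Convergent, p.255 («support»), (2.13) pp.256–257] -/
theorem cover_mem_topSeq_pred_of_within {F : T4Family} (ν : Node00.Stage7Numerics) (Kt : ℕ) {k K : ℕ} (hK1 : 1 ≤ K) (hKk : K ≤ k)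
    (hM : 1 ≤ ν.M₁) (hdiv : side (F.P Kt).L ν.M₁ k ∣ (F.P Kt).sitesPerDir 0) (Z : Set (Site (F.P Kt) 0))
    {y z : Pt (F.P Kt).d} (hy : cover (F.P Kt) y ∈ maxDomT ν.M₁ Z K) {D : ℤ} (hz : Within D y z)
    (hD : D + 1 ≤ (((F.P Kt).L ^ (K - 1) * ν.M₁ : ℕ) : ℤ)) :
    cover (F.P Kt) z ∈ Node00.topSeq (Node00.suppDomOfRecord F ν Kt (maxDomT ν.M₁ Z)) (maxDomT ν.M₁ Z) (K - 1) := by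
  rcases Nat.lt_or_ge 1 K with h2 | h1
  · -- `K ≥ 2`: the printed collar from `Ω_K ⊆ Ω_{(K−2)+1+... }`
    obtain ⟨n, rfl⟩ : ∃ n, K = n + 2 := ⟨K - 2, by omega⟩
    have htop : Node00.topSeq (Node00.suppDomOfRecord F ν Kt (maxDomT ν.M₁ Z)) (maxDomT ν.M₁ Z) (n + 2 - 1) = maxDomT ν.M₁ Z (n + 1) := by
      rw [show n + 2 - 1 = n + 1 by omega, Node00.topSeq_of_ne_zero _ _ (Nat.succ_ne_zero n)]
    rw [htop]
    refine dist_maxDomT hM hdiv (show n + 1 + 1 ≤ k by omega) (x := y) hy (Within.mono ?_ hz)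
    have hmono : (F.P Kt).L ^ (n + 2 - 1) * ν.M₁ ≤ (F.P Kt).L ^ (n + 1 + 1) * ν.M₁ :=
      Nat.mul_le_mul_right _ (Nat.pow_le_pow_right (F.P Kt).L_pos (by omega))
    have h' : D + 1 ≤ (((F.P Kt).L ^ (n + 1 + 1) * ν.M₁ : ℕ) : ℤ) := hD.trans (by exact_mod_cast hmono)
    unfold side
    omega
  · -- `K = 1`: the support layer
    have hK : K = 1 := le_antisymm h1 hK1
    subst hK
    have htop : Node00.topSeq (Node00.suppDomOfRecord F ν Kt (maxDomT ν.M₁ Z)) (maxDomT ν.M₁ Z) (1 - 1) =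
        Node00.hullD (F.P Kt) ν.M₁ 1 (maxDomT ν.M₁ Z 1) := by
      rw [Nat.sub_self, Node00.topSeq_zero]; rfl
    rw [htop]
    rw [Nat.sub_self, pow_zero, one_mul] at hD
    refine Node00.cover_mem_hullD_one_of_within (by omega) hy (Within.mono ?_ hz.symm)
    omega

/-- ★ **THE COORDINATE BOX AROUND A POINT NEAR `Ω_K` LIES IN THE CLASS REGION ONE LEVEL DOWN**: if `x = walkEnd x₀ w₀` with `x₀ ∈ Ω_K`, `|w₀| ≤ D₀`, then every plaquette of the coordinate box of
radius `R` (+2) around `x` has a corner in `topSeq Ω₀ Ω (K−1)` as soon as `D₀ + R + 3 ≤ L^{K−1}·M₁` — so the class ∕ [15]-Thm-1 letter AT LEVEL `K−1` (`ε·η_{K−1}²`) bounds them.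
[cite: Balaban1988Convergent, (2.13) pp.256–257; Balaban1985Variational, (2) p.278; Balaban1985RegularSpaces, (1.7) p.77] -/
theorem boxPlaqs_subset_plaqsOf_topSeq_pred {F : T4Family} (ν : Node00.Stage7Numerics) (Kt : ℕ) {k K : ℕ} (hK1 : 1 ≤ K) (hKk : K ≤ k)
    (hM : 1 ≤ ν.M₁) (hdiv : side (F.P Kt).L ν.M₁ k ∣ (F.P Kt).sitesPerDir 0) (Z : Set (Site (F.P Kt) 0))
    {x₀ x : Site (F.P Kt) 0} (hx₀ : x₀ ∈ maxDomT ν.M₁ Z K) {w₀ : List (Letter (F.P Kt).d)} (hw₀ : walkEnd x₀ w₀ = x)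
    {D₀ R : ℕ} (hD₀ : w₀.length ≤ D₀) (hR : D₀ + R + 3 ≤ (F.P Kt).L ^ (K - 1) * ν.M₁) :
    (boxPlaqs (fun κ => ((x κ).val : ℤ) - (R : ℤ)) (fun κ => ((x κ).val : ℤ) + (R : ℤ) + 2) : Set (Plaq (F.P Kt) 0)) ⊆
      plaqsOf (Node00.topSeq (Node00.suppDomOfRecord F ν Kt (maxDomT ν.M₁ Z)) (maxDomT ν.M₁ Z) (K - 1)) := by
  intro p hp
  obtain ⟨z, hsrc, hwz⟩ := exists_cover_of_mem_boxPlaqs x R hp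
  -- `x₀ = walkEnd x (wordRev w₀) = cover (lift x − netDisp w₀)`
  obtain ⟨hx₀cov, hwx⟩ := walkEnd_eq_cover_and_within x (wordRev w₀)
  have hback : walkEnd x (wordRev w₀) = x₀ := by rw [← hw₀]; exact walkEnd_walkEnd_wordRev x₀ w₀
  rw [hback] at hx₀cov
  have hlen : ((wordRev w₀).length : ℤ) ≤ D₀ := by
    have : (wordRev w₀).length = w₀.length := by simp [wordRev]
    rw [this]; exact_mod_cast hD₀
  have hwithin : Within ((D₀ : ℤ) + ((R : ℤ) + 2)) (fun ν => lift (F.P Kt) x ν + netDisp (wordRev w₀) ν) z :=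
    Within.triangle (Within.mono hlen hwx.symm) hwz
  have hmem := cover_mem_topSeq_pred_of_within ν Kt hK1 hKk hM hdiv Z (y := fun ν => lift (F.P Kt) x ν + netDisp (wordRev w₀) ν)
    (by rw [← hx₀cov]; exact hx₀) hwithin (by
      have h : (((D₀ + R + 3 : ℕ) : ℤ)) ≤ (((F.P Kt).L ^ (K - 1) * ν.M₁ : ℕ) : ℤ) := by exact_mod_cast hR
      push_cast at h ⊢; linarith)
  rw [← hsrc] at hmem
  exact Or.inl hmem

/-! ## §2 The segment plaquette family of a WINDOW-NEAR member has its base one level below the window; words between the ends of a bond -/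

/-- The source centre of a bond is within `Lⁱ` of the centre of either of its ends: `(ι_i c₋)_ν = (ι_i y)_ν + D_ν`, `|D_ν| ≤ Lⁱ`, for `y ∈ {c₋, c₊}`. [cite: Balaban1987RG1, (0.1) p.251 (bookkeeping)] -/
theorem exists_offset_src_of_endpoint {i : ℕ} (hi : i ≤ P.m + P.K) (c : PBond P i) {y : Site P i} (hy : y = c.src ∨ y = c.tgt) :
    ∀ ν, ∃ D : ℤ, |D| ≤ ((P.L ^ i : ℕ) : ℤ) ∧ embIter i c.src ν = embIter i y ν + (D : ZMod (P.sitesPerDir 0)) := by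
  intro ν
  rcases hy with rfl | rfl
  · exact ⟨0, by positivity, by simp⟩
  · have htgt : ∀ ν, (c.tgt : Site P i) ν = c.src ν + (((if ν = c.dir then (1 : ℤ) else 0 : ℤ)) : ZMod (P.sitesPerDir i)) := fun ν => by
      show (c.src.shift c.dir) ν = _
      rw [Site.shift_apply]
      by_cases hν : ν = c.dir
      · subst hν; simp
      · simp [hν]
    have h1 := N12SegmentPlaqFamily.embIter_apply_of_add hi c.src c.tgt (fun ν => if ν = c.dir then 1 else 0) htgt ν
    refine ⟨-(if ν = c.dir then ((P.L ^ i : ℕ) : ℤ) else 0), ?_, ?_⟩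
    · split_ifs <;> simp
    · rw [h1]
      by_cases hν : ν = c.dir
      · subst hν; simp only [if_true]; push_cast; ring
      · simp only [if_neg hν]; push_cast; ring

/-- ★★ **THE BASE OF THE SEGMENT FAMILY OF A WINDOW-NEAR MEMBER LIES ONE LEVEL BELOW THE WINDOW.**  dag-n12-w3's explicit family (`N12SegmentPlaqFamily`: at level `0` the fine plaquettes `q` with
`(q₋)_ν = (ι_i c₋)_ν + E_ν`, `|E_ν| ≤ B_{i,0} = 3Lⁱ + ((d+4)L+2)·Σ_{l<i}Lˡ`) of a level-`i` bond `c` one of whose end centres `ι_i y` is reached from a point `x₀ ∈ Ω_K` by a word of length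
`≤ D₀` followed by a word of length `≤ D₁`: if `D₀ + D₁ + Lⁱ + B_{i,0} + 1 ≤ L^{K−1}·M₁` then every such `q` has a corner in `topSeq Ω₀ Ω (K−1)` — where the class ∕ [15] Thm 1 reads
`ε·η_{K−1}²`, whatever the member's own level `i`.  (dag-n12-w3's `base_subset_topSeq` puts the base two levels below the MEMBER; near the window the member may be read at the WINDOW's depth.)
[cite: Balaban1988Convergent, p.255 («support»), (2.13) pp.256–257; Balaban1985Averaging, Prop. 2 (52)–(53) p.26 (the footprint); Balaban1987RG1, (0.1) p.251] -/
theorem base_subset_topSeq_window {F : T4Family} (ν : Node00.Stage7Numerics) (Kt : ℕ) {k K : ℕ} (hK1 : 1 ≤ K) (hKk : K ≤ k) (hk : k ≤ (F.P Kt).m + (F.P Kt).K)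
    (hM : 1 ≤ ν.M₁) (hdiv : side (F.P Kt).L ν.M₁ k ∣ (F.P Kt).sitesPerDir 0) (Z : Set (Site (F.P Kt) 0))
    {i : ℕ} (hi : i ≤ k) (c : PBond (F.P Kt) i) {y : Site (F.P Kt) i} (hy : y = c.src ∨ y = c.tgt)
    {x₀ x : Site (F.P Kt) 0} (hx₀ : x₀ ∈ maxDomT ν.M₁ Z K) {w₀ w : List (Letter (F.P Kt).d)} (hw₀ : walkEnd x₀ w₀ = x) (hw : walkEnd x w = embIter i y)
    {D₀ D₁ : ℕ} (hD₀ : w₀.length ≤ D₀) (hD₁ : w.length ≤ D₁)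
    (hfit : D₀ + D₁ + (F.P Kt).L ^ i + (3 * (F.P Kt).L ^ i + (((F.P Kt).d + 4) * (F.P Kt).L + 2) * ∑ l ∈ Finset.Ico 0 i, (F.P Kt).L ^ l) + 1 ≤ (F.P Kt).L ^ (K - 1) * ν.M₁)
    {q : Plaq (F.P Kt) 0}
    (hq : ∀ ν, ∃ E : ℤ, |E| ≤ ((3 * (F.P Kt).L ^ i + (((F.P Kt).d + 4) * (F.P Kt).L + 2) * ∑ l ∈ Finset.Ico 0 i, (F.P Kt).L ^ l : ℕ) : ℤ) ∧
      embIter 0 q.src ν = embIter i c.src ν + (E : ZMod ((F.P Kt).sitesPerDir 0))) :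
    q ∈ plaqsOf (Node00.topSeq (Node00.suppDomOfRecord F ν Kt (maxDomT ν.M₁ Z)) (maxDomT ν.M₁ Z) (K - 1)) := by
  classical
  choose E hE hqE using hq
  choose D hD hcD using exists_offset_src_of_endpoint (hi.trans hk) c hy
  -- `x₀ = cover y₀`, `y₀ := lift x − netDisp w₀`
  obtain ⟨hx₀cov, hwx⟩ := walkEnd_eq_cover_and_within x (wordRev w₀)
  have hback : walkEnd x (wordRev w₀) = x₀ := by rw [← hw₀]; exact walkEnd_walkEnd_wordRev x₀ w₀
  rw [hback] at hx₀cov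
  -- `ι_i y = cover (lift x + netDisp w)`
  obtain ⟨hycov, hwy⟩ := walkEnd_eq_cover_and_within x w
  rw [hw] at hycov
  -- the integer point over `q₋`
  set z : Pt (F.P Kt).d := fun ν => lift (F.P Kt) x ν + netDisp w ν + D ν + E ν with hz
  have hsrc : q.src = cover (F.P Kt) z := by
    funext ν
    have h := hqE ν
    have h0 : (embIter 0 q.src) ν = q.src ν := rfl
    rw [← h0, h, hcD ν, hycov, cover_apply, cover_apply, hz]
    push_cast
    ring
  -- the total displacement from `y₀`
  have hlen0 : ((wordRev w₀).length : ℤ) ≤ D₀ := by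
    have : (wordRev w₀).length = w₀.length := by simp [wordRev]
    rw [this]; exact_mod_cast hD₀
  have hwithin : Within ((D₀ : ℤ) + ((D₁ : ℤ) + (((F.P Kt).L ^ i : ℕ) : ℤ) +
      ((3 * (F.P Kt).L ^ i + (((F.P Kt).d + 4) * (F.P Kt).L + 2) * ∑ l ∈ Finset.Ico 0 i, (F.P Kt).L ^ l : ℕ) : ℤ)))
      (fun ν => lift (F.P Kt) x ν + netDisp (wordRev w₀) ν) z := by
    refine Within.triangle (Within.mono hlen0 hwx.symm) fun ν => ?_
    have h1 := abs_netDisp_le_length w ν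
    have h2 := hD ν
    have h3 := hE ν
    have hD₁' : (w.length : ℤ) ≤ D₁ := by exact_mod_cast hD₁
    rw [hz]
    simp only
    rw [show lift (F.P Kt) x ν - (lift (F.P Kt) x ν + netDisp w ν + D ν + E ν) = -(netDisp w ν + D ν + E ν) by ring, abs_neg]
    have h4 := abs_add_le (netDisp w ν + D ν) (E ν)
    have h5 := abs_add_le (netDisp w ν) (D ν)
    linarith
  have hmem := cover_mem_topSeq_pred_of_within ν Kt hK1 hKk hM hdiv Z (y := fun ν => lift (F.P Kt) x ν + netDisp (wordRev w₀) ν)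
    (by rw [← hx₀cov]; exact hx₀) hwithin (by
      have h : (((D₀ + D₁ + (F.P Kt).L ^ i + (3 * (F.P Kt).L ^ i + (((F.P Kt).d + 4) * (F.P Kt).L + 2) * ∑ l ∈ Finset.Ico 0 i, (F.P Kt).L ^ l) + 1 : ℕ) : ℤ)) ≤
          (((F.P Kt).L ^ (K - 1) * ν.M₁ : ℕ) : ℤ) := by exact_mod_cast hfit
      push_cast at h ⊢; linarith)
  rw [← hsrc] at hmem
  exact Or.inl hmem

/-- From one end centre of a level-`i` bond to any end centre of the same bond by a straight word of length `≤ Lⁱ`. [cite: Balaban1987RG1, (0.1) p.251 (bookkeeping)] -/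
theorem exists_word_endpoints {i : ℕ} (c : PBond P i) {e y : Site P i} (he : e = c.src ∨ e = c.tgt) (hy : y = c.src ∨ y = c.tgt) :
    ∃ u : List (Letter P.d), u.length ≤ P.L ^ i ∧ walkEnd (embIter i e) u = embIter i y := by
  rcases he with rfl | rfl <;> rcases hy with rfl | rfl
  · exact ⟨[], by simp, rfl⟩
  · exact ⟨List.replicate (P.L ^ i) (c.dir, true), by simp, (T4ForestGaugeCorridorBound.embIter_tgt_eq_walkEnd_replicate i c).symm⟩
  · refine ⟨List.replicate (P.L ^ i) (c.dir, false), by simp, ?_⟩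
    have h := N12BlockChains.embIter_unshift_eq_walkEnd i (c.tgt : Site P i) c.dir
    have hc : (c.tgt : Site P i).unshift c.dir = c.src := by
      show (c.src.shift c.dir).unshift c.dir = c.src
      exact B10StarCount.unshift_shift _ _
    rw [hc] at h
    exact h.symm
  · exact ⟨[], by simp, rfl⟩

end Summit.QuantumFields.YangMills.BalabanUVNodes.N12WindowNearRegionGeometry

end
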